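import Summits.MatrixMultiplication.OmegaCensus.SmallFormats.MatMul227GF3FootprintCerts0A
import Summits.MatrixMultiplication.OmegaCensus.SmallFormats.MatMul227GF3FootprintCerts0B
import Summits.MatrixMultiplication.OmegaCensus.SmallFormats.MatMul227GF3FootprintCerts0C
import Summits.MatrixMultiplication.OmegaCensus.SmallFormats.MatMul227GF3FootprintCerts1A
import Summits.MatrixMultiplication.OmegaCensus.SmallFormats.MatMul227GF3FootprintCerts1B
import Summits.MatrixMultiplication.OmegaCensus.SmallFormats.MatMul227GF3FootprintCerts1C
import Summits.MatrixMultiplication.OmegaCensus.SmallFormats.MatMul227GF3FootprintCerts2A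
import Summits.MatrixMultiplication.OmegaCensus.SmallFormats.MatMul227GF3FootprintCerts2B
import Summits.MatrixMultiplication.OmegaCensus.SmallFormats.MatMul227GF3FootprintCerts2C
import Summits.MatrixMultiplication.OmegaCensus.SmallFormats.InvertiblePointFootprintExclusionK
import HarnessLib

/-!
# ω-census family (a): `⟨2,2,7⟩ @ 23` over `𝔽₃` — `24 ≤ R_𝔽₃(⟨2,2,7⟩)` conditional ONLY on the completeness of an explicit pencil catalog

Cell `pub-omega` (unit `pub-omega-tensor-g32`), topic `Summits/MatrixMultiplication/OmegaCensus` (sub-folder `SmallFormats`).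
Framing (verbatim): lottery ticket; floor = certified bounds/negative ranges. HONEST FRAMING: an ASSEMBLY. `cat1068` is the census'
(9,7) Weierstraß–Kronecker catalog (kron.py's 1 020 strict-equivalence types of `9 × 7` pencils over `𝔽₃` without zero rows/columns,
regular blocks from elementary divisors of degree ≤ 4, plus the 48 quintic types of GAP48), as 1 068 explicit nine-tuples of `2 × 7`
matrices. KERNEL (this cell): every member is Rado-failed by each transposed representative `REPT j` at `satPoint j`
(`radoFails_cat1068`, 3 204 kernel-checked certificates, files `MatMul227GF3FootprintCerts{0,1,2}{A,B,C}`). HENCE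
`twentyfour_le_tensorRank_227_gf3_of_catalog1068 : CatalogCompleteK 7 9 cat1068 → 24 ≤ R_𝔽₃(⟨2,2,7⟩)`: the (7,23) rung of the census is
a tree theorem conditional on ONE classical statement about an explicit finite list — that every subspace of `𝔽₃^{2×7}` of dimension
`≤ 9` whose members have no common nonzero right-kernel vector is carried into the row span of a member of `cat1068` by some
`W ↦ W Q`, `Q ∈ GL₇(𝔽₃)` (the Weierstraß–Kronecker classification of `9 × 7` pencils over `𝔽₃` without `L₀`/`L₀ᵀ` blocks; Gantmacher
XII §5, BCS 1997 Thm (19.3), Mirwald 1991 for finite fields; NOT proved in the tree). The kernel-vector form `CatalogCompleteK`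
(`InvertiblePointFootprintExclusionK`) is used, NOT the coordinate form `CatalogComplete`, which an `L₀`-free list cannot meet. Nothing on `ω`; this is
NOT an unconditional proof of `24 ≤ R_𝔽₃(⟨2,2,7⟩)`.
-/

namespace Summit.MatrixMultiplication.OmegaCensus.SmallFormats.Enum723

open Module Matrix Literature.Computability.AlgebraicComplexity RankOnePlaneCapGeneral

/-- **The (9,7) catalog of the census**: 1 068 nine-tuples of `2 × 7` matrices over `𝔽₃` (decoded from `catRowsA ++ catRowsB ++ catRowsC`). -/
def cat1068 : List (Fin 9 → Matrix (Fin 2) (Fin 7) (ZMod 3)) := (catRowsA ++ catRowsB ++ catRowsC).map decB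

/-- The catalog has 1 068 members. -/
theorem cat1068_length : cat1068.length = 1068 := by
  rw [cat1068, List.length_map, List.length_append, List.length_append, catRowsA_length, catRowsB_length, catRowsC_length]

/-- **Every catalog member is Rado-failed** by `REPT j` at `satPoint j`, `j < 3` (3 204 kernel-checked certificates). -/
theorem radoFails_cat1068 : ∀ j, j < 3 → ∀ b ∈ cat1068, RadoFails (REPT j) (satPoint j) b := by
  intro j hj b hb
  rw [cat1068, List.mem_map] at hb
  obtain ⟨rows, hrows, rfl⟩ := hb
  rw [List.mem_append, List.mem_append] at hrows
  rcases hrows with (h | h) | h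
  · obtain ⟨idx, hidx, hget⟩ := List.getElem_of_mem h
    have hD : catRowsA.getD idx [] = rows := by rw [List.getD_eq_getElem _ _ hidx, hget]
    rw [catRowsA_length] at hidx
    rw [← hD]
    interval_cases j
    · exact radoFails_0A idx hidx
    · exact radoFails_1A idx hidx
    · exact radoFails_2A idx hidx
  · obtain ⟨idx, hidx, hget⟩ := List.getElem_of_mem h
    have hD : catRowsB.getD idx [] = rows := by rw [List.getD_eq_getElem _ _ hidx, hget]
    rw [catRowsB_length] at hidx
    rw [← hD]
    interval_cases j
    · exact radoFails_0B idx hidx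
    · exact radoFails_1B idx hidx
    · exact radoFails_2B idx hidx
  · obtain ⟨idx, hidx, hget⟩ := List.getElem_of_mem h
    have hD : catRowsC.getD idx [] = rows := by rw [List.getD_eq_getElem _ _ hidx, hget]
    rw [catRowsC_length] at hidx
    rw [← hD]
    interval_cases j
    · exact radoFails_0C idx hidx
    · exact radoFails_1C idx hidx
    · exact radoFails_2C idx hidx

/-- **`24 ≤ R_𝔽₃(⟨2,2,7⟩)` from a kernel-vector-complete `(9,7)` catalog and three Rado-failure tables** (the assembly of
`MatMul227GF3FootprintReduction` with the corrected completeness interface `CatalogCompleteK`). Inputs (C′) and (R) are hypotheses. -/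
theorem twentyfour_le_tensorRank_227_gf3_of_catalogK (cat : List (Fin 9 → Matrix (Fin 2) (Fin 7) (ZMod 3)))
    (hcat : CatalogCompleteK 7 9 cat) (hkill : ∀ j, j < 3 → ∀ b ∈ cat, RadoFails (REPT j) (satPoint j) b) :
    24 ≤ tensorRank (matMulTensor (ZMod 3) 2 2 7) :=
  twentyfour_le_tensorRank_227_gf3_of_exclusion fun j hj =>
    forall_xMarginal_ne_of_transpose fun β =>
      xMarginal_ne_of_catalogK (REPT j) (satPoint j) (isUnit_det_satPoint j) (card_vanishing_satPoint j hj)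
        (by norm_num) cat hcat (hkill j hj) β

/-- **`24 ≤ R_𝔽₃(⟨2,2,7⟩)` conditional ONLY on the (kernel-vector) completeness of the explicit catalog `cat1068`**; input (R) is
discharged by the 3 204 kernel-checked certificates (`radoFails_cat1068`). -/
theorem twentyfour_le_tensorRank_227_gf3_of_catalog1068 (hcat : CatalogCompleteK 7 9 cat1068) :
    24 ≤ tensorRank (matMulTensor (ZMod 3) 2 2 7) :=
  twentyfour_le_tensorRank_227_gf3_of_catalogK cat1068 hcat radoFails_cat1068

/-- **`R_𝔽₃(⟨2,2,7⟩) ∈ [24, 25]` conditional only on the completeness of `cat1068`** (ceiling: Hopcroft–Kerr). -/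
theorem tensorRank_227_gf3_mem_of_catalog1068 (hcat : CatalogCompleteK 7 9 cat1068) :
    tensorRank (matMulTensor (ZMod 3) 2 2 7) ∈ Set.Icc 24 25 :=
  ⟨twentyfour_le_tensorRank_227_gf3_of_catalog1068 hcat, hopcroftKerr1971_tensorRank_matMulTensor_22n_le (K := ZMod 3) 7⟩

end Summit.MatrixMultiplication.OmegaCensus.SmallFormats.Enum723
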